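import Summits.CriticalPhenomena.SAWScalingLimit.Theorems.SAWLeftRightFKGFKGToTraversalBoundBoundaryBudget
import Literature.Probability.RandomPlanarGeometry.CurveTortuosity
import Mathlib.MeasureTheory.Integral.CircleIntegral
import Mathlib.Algebra.Order.ToIntervalMod
import HarnessLib

/-!
# Boundary budget, unit BB7 (part 1): preparations for the assembly of `BoundaryBudget`
(witness unit U6 of line `slit-necklace`)

Crux `SAWLeftRightFKG.FKGToTraversalBound` (stmt-CriticalPhenomena-1878), line `slit-necklace`, lead
prover-line-stmt-CriticalPhenomena-1878-c5-0; wave 6 (the BOUNDARY BUDGET `BoundaryBudget`), unit BB7, part 1 of 2.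

The assembly (part 2, `stub_boundaryBudget`) maps every tour window across the shell whose two end edges face `∂D`
to the pair of FEET of its end edges (first frontier points on the unit segments site → contact, `bb_foot`), thins
the family so that all feet are pairwise distinct, reads the feet as angles on the unit circle through a Schoenflies
homeomorphism, and turns the windows into separate traversals of the thinner shell by the fixed boundary curve,
whose number is finite (`Curve.exists_not_hasTraversals`).  This file holds the sibling-independent preparations:

* `bbB_greedy` — a symmetric conflict relation on `Fin q` in which every element has at most `d` partners admits a
  conflict-free set `S` with `q ≤ (d + 1) · #S` (greedy independent set);
* `bbB_fibre` — if `m ↦ E m` is an injective family of labelled lattice edges and `F m` lies within `|δ|` of the mesh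
  point of the site of `E m`, then at most `100` indices share a common value `F m = c` (their sites lie in a
  `5 × 5` box of lattice points, times `4` directions);
* `bbB_angle`, `bbB_lift` — points of `H '' sphere 0 1` have angles in `[0, 2π)`; lifting a second angle into the
  window `(a, a + 2π]` by `toIocMod` lands strictly inside `(a, a + 2π)` and does not move the circle point;
* `bbB_ite_even`, `bbB_ite_odd`, `bbB_pos_lt`, `bbB_pos_ltN` — bookkeeping of the `2q` window ends indexed by `ℕ`
  (end `2m` = start `a m`, end `2m + 1` = finish `b m`);
* `bbB_traversals` — increasing disjoint parameter windows `[s i, t i] ⊆ [0, 2π)` whose end angles are the two end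
  angles of a window across the shell give `k` separate traversals of the curve `u ↦ G (2π u)`.

All statements folklore; no literature fact is introduced; nothing restates the crux.
-/

noncomputable section

open Filter Topology Set Metric
open Literature.Probability.LatticeModels
open Literature.Probability.RandomPlanarGeometry

namespace Summit.CriticalPhenomena.SAWScalingLimit.Theorems.FKGToTraversalBound.SlitNecklace

/-! ### Greedy conflict-free selection -/

/-- **Greedy independent set.**  For a symmetric relation `r` on `Fin q` in which every `m` has all its partners in
a set of size `≤ d`, there is a set `S` of pairwise unrelated elements with `q ≤ (d + 1) · #S`. [folklore] -/
theorem bbB_greedy : ∀ (q d : ℕ) (r : Fin q → Fin q → Prop), (∀ m m', r m m' → r m' m) → (∀ m, ∃ T : Finset (Fin q), T.card ≤ d ∧ ∀ m', r m m' → m' ∈ T) → ∃ S : Finset (Fin q), q ≤ (d + 1) * S.card ∧ ∀ m ∈ S, ∀ m' ∈ S, m ≠ m' → ¬ r m m' := by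
  intro q d r hsymm hdeg
  classical
  suffices key : ∀ (n : ℕ) (U : Finset (Fin q)), U.card ≤ n → ∃ S : Finset (Fin q), S ⊆ U ∧
      U.card ≤ (d + 1) * S.card ∧ ∀ m ∈ S, ∀ m' ∈ S, m ≠ m' → ¬ r m m' by
    obtain ⟨S, -, hc, hS⟩ := key q Finset.univ (by simp)
    exact ⟨S, by simpa using hc, hS⟩
  intro n
  induction n with
  | zero =>
    intro U hU
    exact ⟨∅, Finset.empty_subset _, by simp [Finset.card_eq_zero.1 (Nat.le_zero.1 hU)], by simp⟩
  | succ n ih =>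
    intro U hU
    rcases U.eq_empty_or_nonempty with rfl | ⟨m, hm⟩
    · exact ⟨∅, Finset.empty_subset _, by simp, by simp⟩
    obtain ⟨T, hTc, hT⟩ := hdeg m
    have hlt : ((U.erase m) \ T).card ≤ n := by
      have h1 : ((U.erase m) \ T).card ≤ (U.erase m).card := Finset.card_le_card Finset.sdiff_subset
      have h2 : (U.erase m).card < U.card := Finset.card_erase_lt_of_mem hm
      omega
    obtain ⟨S', hS'U, hc', hS'⟩ := ih ((U.erase m) \ T) hlt
    have hmS' : m ∉ S' := fun h => by simpa using hS'U h
    refine ⟨insert m S', ?_, ?_, ?_⟩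
    · exact Finset.insert_subset hm (hS'U.trans (Finset.sdiff_subset.trans (Finset.erase_subset m U)))
    · have hcov : U ⊆ insert m (((U.erase m) \ T) ∪ T) := by
        intro u hu
        rw [Finset.mem_insert, Finset.mem_union, Finset.mem_sdiff, Finset.mem_erase]
        by_cases hum : u = m
        · exact Or.inl hum
        · by_cases huT : u ∈ T
          · exact Or.inr (Or.inr huT)
          · exact Or.inr (Or.inl ⟨⟨hum, hu⟩, huT⟩)
      have h1 := (Finset.card_le_card hcov).trans
        ((Finset.card_insert_le _ _).trans (Nat.succ_le_succ (Finset.card_union_le _ _)))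
      rw [Finset.card_insert_of_notMem hmS']
      nlinarith [h1, hc', hTc]
    · intro u hu v hv huv
      rw [Finset.mem_insert] at hu hv
      rcases hu with rfl | hu
      · rcases hv with rfl | hv
        · exact absurd rfl huv
        · exact fun h => (Finset.mem_sdiff.1 (hS'U hv)).2 (hT v h)
      · rcases hv with rfl | hv
        · exact fun h => (Finset.mem_sdiff.1 (hS'U hu)).2 (hT u (hsymm _ _ h))
        · exact hS' u hu v hv huv

/-! ### Fibres of the foot map -/

/-- **Fibres of a foot map are small.**  If `m ↦ E m` is an injective family of labelled lattice edges
(site, direction) and each `F m` lies within `|δ|` (`δ ≠ 0`) of the mesh point of the site of `E m`, then the indices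
with a common value `F m = c` lie in a set of size `≤ 100`: two such sites have mesh points within `2|δ|`, so their
coordinates differ by at most `2`, and an edge is its site offset in `[-2, 2]²` plus its direction. [folklore] -/
theorem bbB_fibre : ∀ (δ : ℝ) (q : ℕ) (E : Fin q → Site 2 × ODir) (F : Fin q → ℂ) (c : ℂ), δ ≠ 0 → Function.Injective E → (∀ m, dist (F m) (meshPoint δ (bsite (E m))) ≤ |δ|) → ∃ T : Finset (Fin q), T.card ≤ 100 ∧ ∀ m, F m = c → m ∈ T := by
  intro δ q E F c hδ hE hdist
  classical
  by_cases hex : ∃ m₀, F m₀ = c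
  swap
  · push Not at hex
    exact ⟨∅, by simp, fun m hm => absurd hm (hex m)⟩
  obtain ⟨m₀, hm₀⟩ := hex
  have hδ' : 0 < |δ| := abs_pos.2 hδ
  -- sites of the fibre are within sup-distance `2` of the site of `E m₀`
  have hco : ∀ m, F m = c → ∀ i : Fin 2, |(bsite (E m)) i - (bsite (E m₀)) i| ≤ 2 := by
    intro m hm i
    have hd : ‖meshPoint δ (bsite (E m)) - meshPoint δ (bsite (E m₀))‖ ≤ 2 * |δ| := by
      rw [← Complex.dist_eq]
      calc dist (meshPoint δ (bsite (E m))) (meshPoint δ (bsite (E m₀)))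
          ≤ dist (meshPoint δ (bsite (E m))) c + dist c (meshPoint δ (bsite (E m₀))) := dist_triangle _ _ _
        _ ≤ |δ| + |δ| := by
            refine add_le_add ?_ ?_
            · rw [dist_comm, ← hm]; exact hdist m
            · rw [← hm₀]; exact hdist m₀
        _ = 2 * |δ| := by ring
    have key : |δ| * |((bsite (E m)) i : ℝ) - (bsite (E m₀)) i| ≤ 2 * |δ| := by
      fin_cases i
      · have h := (Complex.abs_re_le_norm _).trans hd
        rwa [Complex.sub_re, meshPoint_re, meshPoint_re, ← mul_sub, abs_mul] at h
      · have h := (Complex.abs_im_le_norm _).trans hd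
        rwa [Complex.sub_im, meshPoint_im, meshPoint_im, ← mul_sub, abs_mul] at h
    have h2 : |((bsite (E m)) i : ℝ) - (bsite (E m₀)) i| ≤ 2 := by
      by_contra h
      push Not at h
      nlinarith
    have h3 : (|(bsite (E m)) i - (bsite (E m₀)) i| : ℝ) = (((|(bsite (E m)) i - (bsite (E m₀)) i| : ℤ)) : ℝ) := by
      push_cast; ring_nf
    rw [h3] at h2
    exact_mod_cast h2
  -- inject the fibre into a box of `5 · 5 · 4` labelled edges
  let K : Finset ((ℤ × ℤ) × ODir) := (Finset.Icc (-2 : ℤ) 2 ×ˢ Finset.Icc (-2 : ℤ) 2) ×ˢ Finset.univ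
  let φ : Fin q → (ℤ × ℤ) × ODir := fun m =>
    (((bsite (E m)) 0 - (bsite (E m₀)) 0, (bsite (E m)) 1 - (bsite (E m₀)) 1), (E m).2)
  have hK : K.card ≤ 100 := by
    simp only [K, Finset.card_product, Int.card_Icc, Finset.card_univ, Fintype.card_fin]
    decide
  refine ⟨Finset.univ.filter fun m => F m = c, le_trans ?_ hK, fun m hm => by simp [hm]⟩
  refine Finset.card_le_card_of_injOn φ (fun m hm => ?_) (fun m hm m' hm' h => ?_)
  · rw [Finset.coe_filter] at hm
    have hmc : F m = c := hm.2
    have h0 := abs_le.1 (hco m hmc 0)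
    have h1 := abs_le.1 (hco m hmc 1)
    simp only [K, φ, Finset.coe_product, Finset.coe_Icc, Finset.coe_univ, Set.mem_prod, Set.mem_Icc,
      Set.mem_univ, and_true]
    exact ⟨⟨h0.1, h0.2⟩, h1.1, h1.2⟩
  · simp only [φ, Prod.mk.injEq] at h
    obtain ⟨⟨h0, h1⟩, hd⟩ := h
    apply hE
    refine Prod.ext (funext fun i => ?_) hd
    fin_cases i
    · show bsite (E m) 0 = bsite (E m') 0
      omega
    · show bsite (E m) 1 = bsite (E m') 1
      omega

/-! ### Angles on the unit circle -/

/-- A point of `H '' sphere 0 1` is `H (circleMap 0 1 ψ)` for an angle `ψ ∈ [0, 2π)`. [folklore] -/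
theorem bbB_angle : ∀ (H : ℂ ≃ₜ ℂ) (S : Set ℂ) (F : ℂ), H '' Metric.sphere 0 1 = S → F ∈ S → ∃ ψ : ℝ, 0 ≤ ψ ∧ ψ < 2 * Real.pi ∧ H (circleMap 0 1 ψ) = F := by
  intro H S F hS hF
  rw [← hS] at hF
  obtain ⟨z, hz, rfl⟩ := hF
  have hz' : z ∈ Set.range (circleMap 0 1) := by
    rw [range_circleMap, abs_one]; exact hz
  obtain ⟨θ, rfl⟩ := hz'
  refine ⟨toIcoMod Real.two_pi_pos 0 θ, (toIcoMod_mem_Ico' Real.two_pi_pos θ).1,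
    (toIcoMod_mem_Ico' Real.two_pi_pos θ).2, ?_⟩
  rw [← self_sub_toIcoDiv_zsmul, (periodic_circleMap 0 1).sub_zsmul_eq]

/-- **Lifting a second angle.**  For distinct `a, b ∈ [0, 2π)` the representative `toIocMod _ a b` of `b` in
`(a, a + 2π]` lies strictly inside `(a, a + 2π)` and has the same circle point as `b`. [folklore] -/
theorem bbB_lift : ∀ (a b : ℝ), 0 ≤ a → a < 2 * Real.pi → 0 ≤ b → b < 2 * Real.pi → a ≠ b → a < toIocMod Real.two_pi_pos a b ∧ toIocMod Real.two_pi_pos a b < a + 2 * Real.pi ∧ circleMap 0 1 (toIocMod Real.two_pi_pos a b) = circleMap 0 1 b := by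
  intro a b ha0 ha1 hb0 hb1 hab
  rcases lt_or_gt_of_ne hab with h | h
  · have he : toIocMod Real.two_pi_pos a b = b :=
      (toIocMod_eq_self Real.two_pi_pos).2 ⟨h, by linarith⟩
    rw [he]
    exact ⟨h, by linarith, rfl⟩
  · have he : toIocMod Real.two_pi_pos a b = b + 2 * Real.pi := by
      refine (toIocMod_eq_iff Real.two_pi_pos).2 ⟨⟨by linarith, by linarith⟩, -1, ?_⟩
      rw [neg_one_zsmul]; ring
    rw [he]
    exact ⟨by linarith, by linarith, periodic_circleMap 0 1 b⟩

/-! ### The `2q` window ends indexed by `ℕ` -/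

/-- End `2m` of the window family reads the start datum. [folklore] -/
theorem bbB_ite_even : ∀ {α : Type*} (m : ℕ) (u v : ℕ → α), (if (2 * m) % 2 = 0 then u ((2 * m) / 2) else v ((2 * m) / 2)) = u m := by
  intro α m u v
  rw [if_pos (by omega), show 2 * m / 2 = m by omega]

/-- End `2m + 1` of the window family reads the finish datum. [folklore] -/
theorem bbB_ite_odd : ∀ {α : Type*} (m : ℕ) (u v : ℕ → α), (if (2 * m + 1) % 2 = 0 then u ((2 * m + 1) / 2) else v ((2 * m + 1) / 2)) = v m := by
  intro α m u v
  rw [if_neg (by omega), show (2 * m + 1) / 2 = m by omega]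

/-- The end positions `a 0 < b 0 < a 1 < b 1 < ⋯` of strictly separated windows are strictly increasing in the end
index. [folklore] -/
theorem bbB_pos_lt : ∀ (q N : ℕ) (a b : ℕ → ℕ), (∀ m, m < q → a m < b m ∧ b m < N) → (∀ m m', m < m' → m' < q → b m < a m') → ∀ i j, i < j → j < 2 * q → (if i % 2 = 0 then a (i / 2) else b (i / 2)) < (if j % 2 = 0 then a (j / 2) else b (j / 2)) := by
  intro q N a b hab hsep i j hij hj
  obtain ⟨m, rfl | rfl⟩ := Nat.even_or_odd' i <;> obtain ⟨m', rfl | rfl⟩ := Nat.even_or_odd' j <;>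
    simp only [bbB_ite_even, bbB_ite_odd]
  · exact (hab m (by omega)).1.trans (hsep m m' (by omega) (by omega))
  · rcases Nat.lt_or_ge m m' with h | h
    · exact ((hab m (by omega)).1.trans (hsep m m' h (by omega))).trans (hab m' (by omega)).1
    · have hmm : m = m' := by omega
      subst hmm
      exact (hab m (by omega)).1
  · exact hsep m m' (by omega) (by omega)
  · exact (hsep m m' (by omega) (by omega)).trans (hab m' (by omega)).1

/-- All end positions lie in the period `[0, N)`. [folklore] -/
theorem bbB_pos_ltN : ∀ (q N : ℕ) (a b : ℕ → ℕ), (∀ m, m < q → a m < b m ∧ b m < N) → ∀ j, j < 2 * q → (if j % 2 = 0 then a (j / 2) else b (j / 2)) < N := by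
  intro q N a b hab j hj
  obtain ⟨m, rfl | rfl⟩ := Nat.even_or_odd' j <;> simp only [bbB_ite_even, bbB_ite_odd]
  · exact (hab m (by omega)).1.trans (hab m (by omega)).2
  · exact (hab m (by omega)).2

/-! ### From cyclic windows to traversals of the boundary curve -/

/-- **Traversals from angular windows.**  Let `Γ u = G (2π u)` be a curve read off a `2π`-periodic
parametrisation `G`, and let `[s i, t i] ⊆ [0, 2π)` (`i < k`) be increasing, pairwise separated parameter windows
whose two end angles are the two end angles `ψ (2m), ψ (2m + 1)` (in some order) of a window `m < q` ACROSS the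
shell `D(y; r, R)` (one end angle is mapped by `G` into `closedBall y r`, the other outside `ball y R`).  Then `Γ`
has `k` separate traversals of the shell. [folklore] -/
theorem bbB_traversals : ∀ (Γ : Curve ℂ) (G : ℝ → ℂ) (y : ℂ) (r R : ℝ) (q k : ℕ) (ψ : ℕ → ℝ) (s t : Fin k → ℝ), (∀ u : unitInterval, Γ u = G (2 * Real.pi * (u : ℝ))) → (∀ i, 0 ≤ s i ∧ s i < t i ∧ t i < 2 * Real.pi) → (∀ ⦃i j : Fin k⦄, i < j → t i < s j) → (∀ i, ∃ m, m < q ∧ ((s i = ψ (2 * m) ∧ t i = ψ (2 * m + 1)) ∨ (s i = ψ (2 * m + 1) ∧ t i = ψ (2 * m)))) → (∀ m, m < q → (dist (G (ψ (2 * m))) y ≤ r ∧ R ≤ dist (G (ψ (2 * m + 1))) y) ∨ (R ≤ dist (G (ψ (2 * m))) y ∧ dist (G (ψ (2 * m + 1))) y ≤ r)) → Γ.HasTraversals k y r R := by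
  intro Γ G y r R q k ψ s t hΓ hst hsep hwin hside
  have h2π : 0 < 2 * Real.pi := Real.two_pi_pos
  have hmemS : ∀ i, s i / (2 * Real.pi) ∈ unitInterval := fun i =>
    ⟨div_nonneg (hst i).1 h2π.le, (div_le_one h2π).2 (by linarith [(hst i).2.1, (hst i).2.2])⟩
  have hmemT : ∀ i, t i / (2 * Real.pi) ∈ unitInterval := fun i =>
    ⟨div_nonneg ((hst i).1.trans (hst i).2.1.le) h2π.le, (div_le_one h2π).2 (hst i).2.2.le⟩
  have hG : ∀ (x : ℝ) (hx : x / (2 * Real.pi) ∈ unitInterval), Γ ⟨x / (2 * Real.pi), hx⟩ = G x := by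
    intro x hx
    rw [hΓ]
    congr 1
    field_simp
  refine ⟨fun i => ⟨s i / (2 * Real.pi), hmemS i⟩, fun i => ⟨t i / (2 * Real.pi), hmemT i⟩,
    fun i => ⟨?_, ?_⟩, fun i j hij => ?_⟩
  · exact Subtype.mk_le_mk.2 (div_le_div_of_nonneg_right (hst i).2.1.le h2π.le)
  · rw [hG, hG]
    obtain ⟨m, hm, ⟨hs, ht⟩ | ⟨hs, ht⟩⟩ := hwin i
    · rw [hs, ht]
      exact hside m hm
    · rw [hs, ht]
      rcases hside m hm with ⟨h1, h2⟩ | ⟨h1, h2⟩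
      · exact Or.inr ⟨h2, h1⟩
      · exact Or.inl ⟨h2, h1⟩
  · exact Subtype.mk_lt_mk.2 (div_lt_div_of_pos_right (hsep hij) h2π)

end Summit.CriticalPhenomena.SAWScalingLimit.Theorems.FKGToTraversalBound.SlitNecklace

end
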